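import Summits.RiemannHypothesis.RiemannHypothesis.Theorems.Splittings.RobinFiniteDensityTwoLayer
import HarnessLib

/-!
# RobinFiniteDensityLaw — gen 12 ZERO-DENSITY LAYER, part 3/4 (D5, D7): THE DENSITY HEIGHT LAW

Cell rh-split, seat rh-split-robin-finite g12 (card `cards/SPLIT-robin-finite.md` §19).  The tree's c = 1 height law
(`RobinFiniteHeightLaw`, gen 9) pays the unverified zeros `|γ| > T` at the tail-only price `√x·tailH(T)`; parts 1–4 add ONE
explicit zero-density row in print — Fiori–Kadiri–Swidinsky 2023 (J. Math. Anal. Appl. 527, 127426; arXiv:2204.02588) Cor. 2.9,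
Table 2 row `σ ∈ [0.9, 1]`: `N(0.9, T) ≤ 17.4194·T^{4/15}·(log T)^{16/5} + 2.9089·log² T` for `T ≥ H₀ = 3·10¹²` (RH-free; spelled
out as a hypothesis on the tree's count `zetaZeroCountRe 0.9 T`, no named fact introduced) — and show that with it the ZERO SIDE of
the law STOPS BINDING: `RH(T) ∧ {Büthe 2016 Thm 2, Büthe 2018 Thm 2, BKLNW 2021} ∧ FKS-row ⟹ Robin at every CA number with primes
≤ X` for EVERY `X` in Büthe's `θ`-range `4.92·√(X/log X) ≤ T` (`T ≥ 3 000 175 332 800`).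

This part (0 `def`): D5 — the law with an explicit zero-side condition
`(1 + 2/log(2·10²²))·(X^{2/5}·tailH(T) + √X·(16/7)·2600/(T√T)) ≤ 0.4857` (`robinCA_below_of_density`); D7 — the zero side FOLLOWS
from Büthe's range condition for every `T ≥ 3 000 175 332 800` (`zeroSide_of_buthe`: both terms `< 0.06` of the budget `0.4857`;
elementary: `log X ≤ 2·log W` from `X ≤ W·log X`, `log T/T` anti-monotone (Mathlib `Real.log_div_self_antitoneOn`),
`(log T)^{7/5}/T^{1/5} ≤ 109/295` for `log T ≥ 28.5`), whence **`robinCA_below_of_density'`: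
`RH(T) ∧ θ-facts ∧ FKS-row ∧ 4.92·√(X/log X) ≤ T ⟹ robinCA_below (X + 1)`** — the CA reach IS Büthe's `θ`-range
(`X ≈ T²·log T/12`; the tree's tail-only law: `X·log² T ≤ 2.156·T²`).

HONEST LABEL: SPLITTING SEARCH over kernel-typed RH-EQUIVALENCES; a splitting A ∧ B ⟹ RH is CONDITIONAL
bookkeeping unless A and B are both proved; nothing here bears on the truth of RH.
-/

set_option linter.dupNamespace false

noncomputable section

open Real Filter Finset
open scoped Chebyshev ComplexConjugate

namespace Summit.RiemannHypothesis.RiemannHypothesis.Theorems.Splittings.RobinFiniteC1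

open Literature.NumberTheory.LFunctions Literature.NumberTheory.DiophantineGeometry
open Literature.NumberTheory.LFunctions.SchoenfeldBound
open Literature.NumberTheory.LFunctions.NicolasJExplicit
open RobinAnalyticSharp
open Summit.RiemannHypothesis.RiemannHypothesis.Theorems.Splittings.RobinFiniteE3
open Summit.RiemannHypothesis.RiemannHypothesis.Theorems.Splittings.RobinFiniteTail
  (zeroTailBound_tailH tailH_PT_le tailH_nonneg)
open Summit.RiemannHypothesis.RiemannHypothesis.Theorems.Splittings.RobinFiniteE1c (summable_tailTerm)

section Density

/-! ### D5 · THE DENSITY HEIGHT LAW -/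

/-- **THE DENSITY HEIGHT LAW.**  The three RH-free `θ`-facts in print, the explicit density row (FKS 2023 Cor. 2.9, `σ ∈ [0.9,1]`,
RH-free, in print) and RH verified to ANY height `T ≥ 3 000 175 332 800` give Robin's inequality at every colossally abundant
`N > 5040` all of whose primes are `≤ X`, for every natural `X` with (θ-side) Büthe's range condition `4.92·√(X/log X) ≤ T` and
(zero side) `(1 + 2/log(2·10²²))·(X^{2/5}·tailH(T) + √X·(16/7)·2600/(T√T)) ≤ 0.4857`.  For `T ≥ 3 000 175 332 800` the `θ`-side
BINDS (it allows `X ≈ T²·log X/24.2`; the zero side would allow `X ≈ (0.45·πT/log T)^{5/2}`).  Nothing here bears on the truth of RH. -/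
theorem robinCA_below_of_density (h16 : Buthe2016_thm2) (hB : Buthe2018_thm2_theta)
    (hK : BroadbentEtAl2021_theta_rel_1e19)
    (hZD : ∀ t : ℝ, 3 * (10 : ℝ) ^ 12 ≤ t →
      (zetaZeroCountRe 0.9 t : ℝ) ≤ 17.4194 * t ^ (4 / 15 : ℝ) * Real.log t ^ (16 / 5 : ℝ) + 2.9089 * Real.log t ^ 2)
    {T : ℝ} (hT : 3000175332800 ≤ T) (hRH : RiemannHypothesisUpTo T) {X : ℕ}
    (hBu : 4.92 * Real.sqrt ((X : ℝ) / Real.log X) ≤ T)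
    (hκ : (1 + 2 / Real.log (2 * (10 : ℝ) ^ 22)) *
      ((X : ℝ) ^ (2 / 5 : ℝ) * ((Real.log (T / (2 * π)) + 1) / (π * T) + (184 + 30 * Real.log T) / T ^ 2) +
        √(X : ℝ) * (16 / 7 * (2600 / (T * √T)))) ≤ 0.4857) :
    robinCA_below (X + 1) := by
  have hT12 : 3 * (10 : ℝ) ^ 12 ≤ T := le_trans (by norm_num) hT
  have hN := count09_le_of_densityRow hZD
  have hT0 : 0 < T := lt_of_lt_of_le (by norm_num) hT
  have htH := tailH_nonneg (le_trans (by norm_num) hT : (7 : ℝ) ≤ T)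
  have hc0 : 0 ≤ 16 / 7 * (2600 / (T * √T)) := by positivity
  refine robinCA_below_of_offLine h16 hB hK hT hRH (fun x hx hxX => ?_) ?_ hκ hBu
  · have hx1 : 1 ≤ x := le_trans (by norm_num) hx
    refine (offLine_le_twoLayer hT12 hN hx1).trans ?_
    have h1 : x ^ (2 / 5 : ℝ) ≤ (X : ℝ) ^ (2 / 5 : ℝ) := Real.rpow_le_rpow (by linarith) hxX (by norm_num)
    have h2 : √x ≤ √(X : ℝ) := Real.sqrt_le_sqrt hxX
    exact add_le_add (mul_le_mul_of_nonneg_right h1 htH) (mul_le_mul_of_nonneg_right h2 hc0)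
  · exact add_nonneg (mul_nonneg (Real.rpow_nonneg (Nat.cast_nonneg X) _) htH) (mul_nonneg (Real.sqrt_nonneg _) hc0)

/-! ### D7 · the zero side FOLLOWS from the `θ`-side for every `T ≥ H₀`: the law with Büthe's range condition ALONE -/

/-- `log X ≤ 2·log W` whenever `1 < X ≤ W·log X` (`W > 0`): otherwise `exp(L/2) > W` and `exp(L/2) ≥ 1 + L/2 + L²/8 ≥ L`
(`L = log X`) would give `X = exp(L/2)² > W·L`. -/
theorem log_le_two_mul_log {X W : ℝ} (hX : 1 < X) (hW : 0 < W) (h : X ≤ W * Real.log X) :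
    Real.log X ≤ 2 * Real.log W := by
  by_contra hlt
  rw [not_le] at hlt
  have hX0 : 0 < X := by linarith
  obtain ⟨L, hL⟩ : ∃ L : ℝ, Real.log X = L := ⟨_, rfl⟩
  rw [hL] at h hlt
  have hL0 : 0 < L := by rw [← hL]; exact Real.log_pos hX
  have h1 : W < Real.exp (L / 2) := by
    rw [← Real.log_lt_iff_lt_exp hW]; linarith
  have h2 : L ≤ Real.exp (L / 2) := by
    have := Real.quadratic_le_exp_of_nonneg (show 0 ≤ L / 2 by positivity)
    nlinarith
  have h3 : X = Real.exp (L / 2) * Real.exp (L / 2) := by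
    rw [← Real.exp_add, add_halves, ← hL, Real.exp_log hX0]
  have h4 : W * L < Real.exp (L / 2) * Real.exp (L / 2) := mul_lt_mul h1 h2 hL0 (Real.exp_pos _).le
  linarith

/-- `4^{2/5} ≤ 1.75` (`4² ≤ 1.75⁵`). -/
theorem rpow_four_le : (4 : ℝ) ^ (2 / 5 : ℝ) ≤ 1.75 := by
  have e : (2 / 5 : ℝ) = ((2 : ℕ) : ℝ) * (((5 : ℕ) : ℝ)⁻¹) := by norm_num
  rw [e, Real.rpow_mul (by norm_num), Real.rpow_natCast]
  calc ((((4 : ℝ) ^ (2 : ℕ)) ^ (((5 : ℕ) : ℝ)⁻¹)) : ℝ) ≤ ((1.75 : ℝ) ^ (5 : ℕ)) ^ (((5 : ℕ) : ℝ)⁻¹) :=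
        Real.rpow_le_rpow (by positivity) (by norm_num) (by positivity)
    _ = 1.75 := Real.pow_rpow_inv_natCast (by norm_num) (by norm_num)

/-- `3.57 ≤ 4.92^{4/5}` (`3.57⁵ ≤ 4.92⁴`). -/
theorem rpow_492_ge : (3.57 : ℝ) ≤ (4.92 : ℝ) ^ (4 / 5 : ℝ) := by
  have e : (4 / 5 : ℝ) = ((4 : ℕ) : ℝ) * (((5 : ℕ) : ℝ)⁻¹) := by norm_num
  rw [e, Real.rpow_mul (by norm_num), Real.rpow_natCast]
  calc (3.57 : ℝ) = ((3.57 : ℝ) ^ (5 : ℕ)) ^ (((5 : ℕ) : ℝ)⁻¹) := (Real.pow_rpow_inv_natCast (by norm_num) (by norm_num)).symm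
    _ ≤ (((4.92 : ℝ) ^ (4 : ℕ)) ^ (((5 : ℕ) : ℝ)⁻¹) : ℝ) := Real.rpow_le_rpow (by positivity) (by norm_num) (by positivity)

/-- `28.5^{7/5} ≤ 109` (`28.5⁷ ≤ 109⁵`). -/
theorem rpow_285_75_le : (28.5 : ℝ) ^ (7 / 5 : ℝ) ≤ 109 := by
  have e : (7 / 5 : ℝ) = ((7 : ℕ) : ℝ) * (((5 : ℕ) : ℝ)⁻¹) := by norm_num
  rw [e, Real.rpow_mul (by norm_num), Real.rpow_natCast]
  calc ((((28.5 : ℝ) ^ (7 : ℕ)) ^ (((5 : ℕ) : ℝ)⁻¹)) : ℝ) ≤ ((109 : ℝ) ^ (5 : ℕ)) ^ (((5 : ℕ) : ℝ)⁻¹) :=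
        Real.rpow_le_rpow (by positivity) (by norm_num) (by positivity)
    _ = 109 := Real.pow_rpow_inv_natCast (by norm_num) (by norm_num)

/-- `295 ≤ exp 5.7` (`e ≥ 2.7182818283`, `exp 0.35 ≥ 1 + 0.35 + 0.35²/2`). -/
theorem exp_57_ge : (295 : ℝ) ≤ Real.exp 5.7 := by
  have h1 : Real.exp 1 ^ 5 * Real.exp 0.35 ^ 2 = Real.exp 5.7 := by
    rw [← Real.exp_nat_mul, ← Real.exp_nat_mul, ← Real.exp_add]; norm_num
  have h2 : (2.7182818283 : ℝ) ^ 5 ≤ Real.exp 1 ^ 5 := pow_le_pow_left₀ (by norm_num) Real.exp_one_gt_d9.le 5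
  have h3 : (1 + 0.35 + 0.35 ^ 2 / 2 : ℝ) ^ 2 ≤ Real.exp 0.35 ^ 2 :=
    pow_le_pow_left₀ (by norm_num) (Real.quadratic_le_exp_of_nonneg (by norm_num)) 2
  rw [← h1]
  calc (295 : ℝ) ≤ 2.7182818283 ^ 5 * (1 + 0.35 + 0.35 ^ 2 / 2) ^ 2 := by norm_num
    _ ≤ Real.exp 1 ^ 5 * Real.exp 0.35 ^ 2 := mul_le_mul h2 h3 (by positivity) (by positivity)

/-- `(log T)^{7/5}/T^{1/5} ≤ 109/295` for `log T = u ≥ 28.5`, in the form `exp(u·(4/5 − 1))·exp((7/5)·log u) ≤ 109/295`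
(`log u ≤ log 28.5 + 2u/57 − 1`; the exponent `(7/5)(2u/57 − 1) − u/5` is `≤ −5.7` for `u ≥ 28.5`). -/
theorem upow_div_le {u : ℝ} (hu : 28.5 ≤ u) :
    Real.exp (u * (4 / 5 - 1)) * Real.exp (7 / 5 * Real.log u) ≤ 109 / 295 := by
  have hu0 : 0 < u := by linarith
  have hlogu : Real.log u ≤ Real.log 28.5 + (2 * u / 57 - 1) := by
    have h := Real.log_le_sub_one_of_pos (show 0 < u / 28.5 by positivity)
    rw [Real.log_div hu0.ne' (by norm_num)] at h
    have e : u / 28.5 = 2 * u / 57 := by norm_num; ring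
    rw [e] at h
    linarith
  have h285 : Real.exp (7 / 5 * Real.log 28.5) ≤ 109 := by
    have : Real.exp (7 / 5 * Real.log 28.5) = (28.5 : ℝ) ^ (7 / 5 : ℝ) := by
      rw [Real.rpow_def_of_pos (by norm_num : (0 : ℝ) < 28.5)]; ring_nf
    rw [this]; exact rpow_285_75_le
  have hinv : Real.exp (-5.7) ≤ 1 / 295 := by
    rw [Real.exp_neg, one_div]; exact inv_anti₀ (by norm_num) exp_57_ge
  rw [← Real.exp_add]
  calc Real.exp (u * (4 / 5 - 1) + 7 / 5 * Real.log u)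
      ≤ Real.exp (7 / 5 * Real.log 28.5 + (-5.7)) := Real.exp_le_exp.2 (by nlinarith)
    _ = Real.exp (7 / 5 * Real.log 28.5) * Real.exp (-5.7) := Real.exp_add _ _
    _ ≤ 109 * (1 / 295) := mul_le_mul h285 hinv (Real.exp_pos _).le (by norm_num)
    _ = 109 / 295 := by norm_num

/-- **The zero side follows from the `θ`-side for EVERY `T ≥ 3 000 175 332 800`.**  If `4.92·√(X/log X) ≤ T` (`X ≥ 0`) then
`(1 + 2/log(2·10²²))·(X^{2/5}·tailH(T) + √X·(16/7)·2600/(T√T)) ≤ 0.07 ≤ 0.4857`.  With `W = (T/4.92)²`: `X ≤ W·log X` gives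
`log X ≤ 2·log W ≤ 4·log T` (`log_le_two_mul_log`), so `X^{2/5} ≤ (T^{4/5}/3.57)·1.75·(log T)^{2/5}` and `√X ≤ (T/4.92)·2√(log T)`;
with `tailH(T) ≤ log T/(πT)`, `(log T)^{7/5}/T^{1/5} ≤ 109/295` (`log T ≥ 28.5`) and `log T/T ≤ 28.7824/H₀ ≤ 9.61·10⁻¹²` the two
terms are `≤ 0.058` and `≤ 0.0075`. -/
theorem zeroSide_of_buthe {T : ℝ} (hT : 3000175332800 ≤ T) {X : ℝ} (hX0 : 0 ≤ X)
    (hBu : 4.92 * Real.sqrt (X / Real.log X) ≤ T) :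
    (1 + 2 / Real.log (2 * (10 : ℝ) ^ 22)) *
      (X ^ (2 / 5 : ℝ) * ((Real.log (T / (2 * π)) + 1) / (π * T) + (184 + 30 * Real.log T) / T ^ 2) +
        √X * (16 / 7 * (2600 / (T * √T)))) ≤ 0.4857 := by
  have hT0 : 0 < T := lt_of_lt_of_le (by norm_num) hT
  have hT12 : 3 * (10 : ℝ) ^ 12 ≤ T := le_trans (by norm_num) hT
  have hπ := Real.pi_gt_d2
  have hsT : 0 < √T := Real.sqrt_pos.2 hT0
  -- the factor `1 + 2/log(2·10²²) ≤ 1.0389484`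
  obtain ⟨hL22, -⟩ := log_2e22_bounds
  have hfac : 1 + 2 / Real.log (2 * (10 : ℝ) ^ 22) ≤ 1.0389484 := by
    have h4 : 2 / Real.log (2 * (10 : ℝ) ^ 22) ≤ 2 / 51.35 := div_le_div_of_nonneg_left (by norm_num) (by norm_num) hL22
    calc 1 + 2 / Real.log (2 * (10 : ℝ) ^ 22) ≤ 1 + 2 / 51.35 := add_le_add le_rfl h4
      _ ≤ 1.0389484 := by norm_num
  -- `u = log T ≥ 28.5`, `u/T ≤ 9.61e-12`, `tailH(T) ≤ u/(πT)`
  obtain ⟨u, hu⟩ : ∃ u : ℝ, Real.log T = u := ⟨_, rfl⟩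
  have hu285 : 28.5 ≤ u := by
    rw [← hu, Real.le_log_iff_exp_le hT0]; exact exp_285_le.trans hT12
  have hu0 : 0 < u := by linarith
  have huT : u / T ≤ 9.61e-12 := by
    have hH : Real.log 3000175332800 ≤ 28.7824 := by
      have h2 : Real.log ((3000175332800 : ℝ) ^ 2) ≤ Real.log ((10 : ℝ) ^ 25) :=
        Real.log_le_log (by positivity) (by norm_num)
      rw [Real.log_pow, Real.log_pow] at h2
      have h10 := RobinAnalytic.log_ten_lt
      push_cast at h2
      linarith
    have he : Real.exp 1 ≤ 3000175332800 := le_trans Real.exp_one_lt_d9.le (by norm_num)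
    have h1 : Real.log T / T ≤ Real.log 3000175332800 / 3000175332800 :=
      Real.log_div_self_antitoneOn he (le_trans he hT) hT
    rw [hu] at h1
    refine h1.trans ?_
    rw [div_le_iff₀ (by norm_num : (0 : ℝ) < 3000175332800)]
    linarith
  have htail : (Real.log (T / (2 * π)) + 1) / (π * T) + (184 + 30 * Real.log T) / T ^ 2 ≤ u / (π * T) :=
    (tailH_le_log_div hT).trans_eq (by rw [hu])
  have htail0 := tailH_nonneg (le_trans (by norm_num) hT : (7 : ℝ) ≤ T)
  -- the density coefficient at `T` is at most its value at `H₀`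
  have h3 : (1732050 : ℝ) ≤ √3000175332800 := Real.le_sqrt_of_sq_le (by norm_num)
  have hsTH : (1732050 : ℝ) ≤ √T := h3.trans (Real.sqrt_le_sqrt hT)
  have hc : 16 / 7 * (2600 / (T * √T)) ≤ 16 / 7 * (2600 / (3000175332800 * 1732050)) := by gcongr
  have hc0 : 0 ≤ 16 / 7 * (2600 / (T * √T)) := by positivity
  rcases le_or_gt X 1 with hX1 | hX1
  · -- tiny `X`: both terms are negligible
    have h1 : X ^ (2 / 5 : ℝ) ≤ 1 := Real.rpow_le_one hX0 hX1 (by norm_num)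
    have h2 : √X ≤ 1 := Real.sqrt_le_one.mpr hX1 |>.trans_eq rfl
    have ht1 : u / (π * T) ≤ 9.61e-12 := by
      calc u / (π * T) = u / T / π := by rw [div_div, mul_comm]
        _ ≤ u / T / 1 := div_le_div_of_nonneg_left (div_nonneg hu0.le hT0.le) one_pos (by linarith)
        _ ≤ 9.61e-12 := by rw [div_one]; exact huT
    have hsum : X ^ (2 / 5 : ℝ) * ((Real.log (T / (2 * π)) + 1) / (π * T) + (184 + 30 * Real.log T) / T ^ 2) +
        √X * (16 / 7 * (2600 / (T * √T))) ≤ 1 * 9.61e-12 + 1 * (16 / 7 * (2600 / (3000175332800 * 1732050))) :=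
      add_le_add (mul_le_mul h1 (htail.trans ht1) htail0 zero_le_one) (mul_le_mul h2 hc hc0 zero_le_one)
    have hpos : 0 ≤ X ^ (2 / 5 : ℝ) * ((Real.log (T / (2 * π)) + 1) / (π * T) + (184 + 30 * Real.log T) / T ^ 2) +
        √X * (16 / 7 * (2600 / (T * √T))) := add_nonneg (mul_nonneg (Real.rpow_nonneg hX0 _) htail0) (by positivity)
    have hfac0 : 0 ≤ (1.0389484 : ℝ) := by norm_num
    calc _ ≤ 1.0389484 * (1 * 9.61e-12 + 1 * (16 / 7 * (2600 / (3000175332800 * 1732050)))) :=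
          mul_le_mul hfac hsum hpos hfac0
      _ ≤ 0.4857 := by norm_num
  · -- `1 < X`: `X ≤ W·L`, `L ≤ 4u`
    have hX0' : 0 < X := by linarith
    obtain ⟨L, hL⟩ : ∃ L : ℝ, Real.log X = L := ⟨_, rfl⟩
    have hL0 : 0 < L := by rw [← hL]; exact Real.log_pos hX1
    set W : ℝ := (T / 4.92) ^ 2 with hW
    have hW0 : 0 < W := by positivity
    have hXWL : X ≤ W * L := by
      have h1 : √(X / L) ≤ T / 4.92 := by
        rw [le_div_iff₀ (by norm_num : (0 : ℝ) < 4.92), mul_comm, hL.symm]  -- careful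
        exact hBu
      have h2 : X / L ≤ (T / 4.92) ^ 2 := (Real.sqrt_le_left (by positivity)).1 h1
      rwa [div_le_iff₀ hL0] at h2
    have hL2W : L ≤ 2 * Real.log W := by
      have := log_le_two_mul_log hX1 hW0 (by rwa [hL]); rwa [hL] at this
    have hlogW : Real.log W ≤ 2 * u := by
      rw [hW, Real.log_pow, ← hu]; push_cast
      have : Real.log (T / 4.92) ≤ Real.log T :=
        Real.log_le_log (by positivity) (div_le_self hT0.le (by norm_num))
      linarith
    have hL4 : L ≤ 4 * u := by linarith
    have hXW4 : X ≤ W * (4 * u) := hXWL.trans (mul_le_mul_of_nonneg_left hL4 hW0.le)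
    -- term 2: `√X·c ≤ (83200/34.44)·√(u/T) ≤ 0.0075`
    have hsX : √X ≤ T / 4.92 * (2 * √u) := by
      have e1 : √(W * (4 * u)) = T / 4.92 * (2 * √u) := by
        rw [Real.sqrt_mul' _ (by positivity), hW, Real.sqrt_sq (by positivity), Real.sqrt_mul' _ hu0.le,
          show √(4 : ℝ) = 2 by rw [show (4 : ℝ) = 2 ^ 2 by norm_num]; exact Real.sqrt_sq (by norm_num)]
      rw [← e1]; exact Real.sqrt_le_sqrt hXW4
    have hsuT : √u / √T ≤ 3.1e-6 := by
      rw [← Real.sqrt_div' u hT0.le, Real.sqrt_le_left (by norm_num)]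
      exact huT.trans (by norm_num)
    have hterm2 : √X * (16 / 7 * (2600 / (T * √T))) ≤ 0.0075 := by
      calc √X * (16 / 7 * (2600 / (T * √T))) ≤ T / 4.92 * (2 * √u) * (16 / 7 * (2600 / (T * √T))) :=
            mul_le_mul_of_nonneg_right hsX hc0
        _ = 83200 / 34.44 * (√u / √T) := by field_simp; ring
        _ ≤ 83200 / 34.44 * 3.1e-6 := mul_le_mul_of_nonneg_left hsuT (by norm_num)
        _ ≤ 0.0075 := by norm_num
    -- term 1: `X^{2/5}·tailH ≤ (1.75/(3.57π))·(109/295) ≤ 0.058`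
    have hX25 : X ^ (2 / 5 : ℝ) ≤ T ^ (4 / 5 : ℝ) / 3.57 * (1.75 * u ^ (2 / 5 : ℝ)) := by
      have h1 : X ^ (2 / 5 : ℝ) ≤ (W * (4 * u)) ^ (2 / 5 : ℝ) := Real.rpow_le_rpow hX0 hXW4 (by norm_num)
      have h2 : (W * (4 * u)) ^ (2 / 5 : ℝ) = W ^ (2 / 5 : ℝ) * ((4 : ℝ) ^ (2 / 5 : ℝ) * u ^ (2 / 5 : ℝ)) := by
        rw [Real.mul_rpow hW0.le (by positivity), Real.mul_rpow (by norm_num) hu0.le]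
      have h3 : W ^ (2 / 5 : ℝ) = T ^ (4 / 5 : ℝ) / (4.92 : ℝ) ^ (4 / 5 : ℝ) := by
        rw [hW, show ((T / 4.92) ^ 2 : ℝ) = (T / 4.92) ^ (2 : ℝ) by rw [← Real.rpow_natCast]; norm_num,
          ← Real.rpow_mul (by positivity), show (2 : ℝ) * (2 / 5) = 4 / 5 by norm_num,
          Real.div_rpow hT0.le (by norm_num)]
      have h4 : T ^ (4 / 5 : ℝ) / (4.92 : ℝ) ^ (4 / 5 : ℝ) ≤ T ^ (4 / 5 : ℝ) / 3.57 :=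
        div_le_div_of_nonneg_left (Real.rpow_nonneg hT0.le _) (by norm_num) rpow_492_ge
      have h5 : (4 : ℝ) ^ (2 / 5 : ℝ) * u ^ (2 / 5 : ℝ) ≤ 1.75 * u ^ (2 / 5 : ℝ) :=
        mul_le_mul_of_nonneg_right rpow_four_le (Real.rpow_nonneg hu0.le _)
      rw [h2, h3] at h1
      exact h1.trans (mul_le_mul h4 h5 (by positivity) (by positivity))
    have hq : T ^ (4 / 5 : ℝ) * u ^ (2 / 5 : ℝ) * u / T ≤ 109 / 295 := by
      have e1 : T ^ (4 / 5 : ℝ) * u ^ (2 / 5 : ℝ) * u / T = T ^ ((4 / 5 : ℝ) - 1) * u ^ ((2 / 5 : ℝ) + 1) := by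
        rw [Real.rpow_sub_one hT0.ne', Real.rpow_add_one hu0.ne']; ring
      rw [e1, Real.rpow_def_of_pos hT0, Real.rpow_def_of_pos hu0, hu,
        show ((2 / 5 : ℝ) + 1) = 7 / 5 by norm_num, show Real.log u * (7 / 5) = 7 / 5 * Real.log u by ring]
      exact upow_div_le hu285
    have hterm1 : X ^ (2 / 5 : ℝ) * ((Real.log (T / (2 * π)) + 1) / (π * T) + (184 + 30 * Real.log T) / T ^ 2) ≤
        0.058 := by
      have hb0 : 0 ≤ T ^ (4 / 5 : ℝ) / 3.57 * (1.75 * u ^ (2 / 5 : ℝ)) := by positivity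
      calc X ^ (2 / 5 : ℝ) * ((Real.log (T / (2 * π)) + 1) / (π * T) + (184 + 30 * Real.log T) / T ^ 2)
          ≤ T ^ (4 / 5 : ℝ) / 3.57 * (1.75 * u ^ (2 / 5 : ℝ)) * (u / (π * T)) := mul_le_mul hX25 htail htail0 hb0
        _ = 1.75 / (3.57 * π) * (T ^ (4 / 5 : ℝ) * u ^ (2 / 5 : ℝ) * u / T) := by
            field_simp
        _ ≤ 1.75 / (3.57 * π) * (109 / 295) := mul_le_mul_of_nonneg_left hq (by positivity)
        _ ≤ 1.75 / (3.57 * 3.14) * (109 / 295) := by gcongr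
        _ ≤ 0.058 := by norm_num
    have hpos : 0 ≤ X ^ (2 / 5 : ℝ) * ((Real.log (T / (2 * π)) + 1) / (π * T) + (184 + 30 * Real.log T) / T ^ 2) +
        √X * (16 / 7 * (2600 / (T * √T))) := add_nonneg (mul_nonneg (Real.rpow_nonneg hX0 _) htail0) (by positivity)
    calc _ ≤ 1.0389484 * (0.058 + 0.0075) := mul_le_mul hfac (add_le_add hterm1 hterm2) hpos (by norm_num)
      _ ≤ 0.4857 := by norm_num

/-- **THE DENSITY HEIGHT LAW — final form: the CA reach IS Büthe's `θ`-range.**  The three RH-free `θ`-facts, the RH-free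
density row (FKS 2023 Cor. 2.9, `σ ∈ [0.9, 1]`) and RH verified to any height `T ≥ 3 000 175 332 800` give Robin's inequality
at every colossally abundant `N > 5040` all of whose primes are `≤ X`, for EVERY natural `X` with `4.92·√(X/log X) ≤ T`
(Büthe 2016 Thm 2's range: `X/log X ≤ T²/24.2064`, i.e. `X ≈ T²·log T/12`).  The tail-only law of the tree needs
`X·(log T)² ≤ 2.156·T²` (`robinCA_below_of_height_closed`): the density layer buys the factor `≈ (log T)³/26`
(`≈ 900` at `T = H₀`).  Nothing here bears on the truth of RH. -/
theorem robinCA_below_of_density' (h16 : Buthe2016_thm2) (hB : Buthe2018_thm2_theta)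
    (hK : BroadbentEtAl2021_theta_rel_1e19)
    (hZD : ∀ t : ℝ, 3 * (10 : ℝ) ^ 12 ≤ t →
      (zetaZeroCountRe 0.9 t : ℝ) ≤ 17.4194 * t ^ (4 / 15 : ℝ) * Real.log t ^ (16 / 5 : ℝ) + 2.9089 * Real.log t ^ 2)
    {T : ℝ} (hT : 3000175332800 ≤ T) (hRH : RiemannHypothesisUpTo T) {X : ℕ}
    (hBu : 4.92 * Real.sqrt ((X : ℝ) / Real.log X) ≤ T) :
    robinCA_below (X + 1) :=
  robinCA_below_of_density h16 hB hK hZD hT hRH hBu (zeroSide_of_buthe hT (Nat.cast_nonneg X) hBu)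

end Density

end Summit.RiemannHypothesis.RiemannHypothesis.Theorems.Splittings.RobinFiniteC1

end
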